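import Literature.Analysis.FluidPDE.TaoCascadeFiveModes
import HarnessLib

/-!
# Tao's cascade ODE, §6.6: the coarse-scale equations (6.134)–(6.137) with explicit errors

T. Tao, *Finite time blowup for an averaged three-dimensional Navier–Stokes equation*,
J. Amer. Math. Soc. **29** (2016), 601–674 = arXiv:1402.0290v3, §6.6, the display (6.134)–(6.137):
"When `N > n₀`, we also need to keep some track of the modes `a₋₁, b₋₁, c₋₁, d₋₁`; again from
(6.45)–(6.48) and (6.92)–(6.94), these equations may be given as
`∂ₜa₋₁ = -(1+ε₀)^{-5/2}ε⁻²c₋₁d₋₁ + O(K⁻⁹)`,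
`∂ₜb₋₁ = (1+ε₀)^{-5/2}εa₋₁² - (1+ε₀)^{-5/2}ε⁻¹K^{10}c₋₁² + O((1+ε₀)^{-n₀/2})`,
`∂ₜc₋₁ = (1+ε₀)^{-5/2}ε²exp(-K^{10})a₋₁² + (1+ε₀)^{-5/2}ε⁻¹K^{10}b₋₁c₋₁ + O((1+ε₀)^{-n₀/2})`,
`∂ₜd₋₁ = (1+ε₀)^{-5/2}ε⁻²c₋₁a₋₁ - Kd₋₁a₀ + O((1+ε₀)^{-n₀/2})`."

As in `TaoCascadeFiveModes.lean` for the zero scale, they are derived here **pointwise in time**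
from `RescaledHypotheses γ …` (`TaoCascadeRescaled.lean`) and pointwise energy bounds
`Ẽ₋₁(t) ≤ E₁`, `Ẽ₋₂(t) ≤ E₂` (the bootstrap bounds (6.92) at `m = 2, 3`), with explicit errors and
in the shapes consumed by `TaoCascadeCoarseNoExit.lean` (`ρ = (1+ε₀)^{-5/2}ε⁻²`, `κ = K`) and by the
growth lemmas of `TaoCascadeZeroScaleGrowth.lean`; together with the energy inequality (6.49) at
scale `-1` with its input term `K(1+ε₀)^{-5/2}d₋₂²a₋₁` bounded ((6.177): "`∂ₜẼ₋₁ ≤ -Kd₋₁²a₀ + O(K^{-14})`").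

## References

* T. Tao, J. Amer. Math. Soc. 29 (2016), 601–674, arXiv:1402.0290v3, §6.4 (6.45)–(6.49), §6.6
  (6.134)–(6.137), §6.7 (6.177). [`Tao2016AveragedNS`]
-/

noncomputable section

open Set MeasureTheory

namespace Literature.Analysis.FluidPDE

namespace TaoCascade

section CoarseModes

variable {γ ε₀ K ε C₁ C₂ C₃ : ℝ} {n₀ N : ℤ} {τ : ℤ → ℝ} {Xr : Fin 4 → ℤ → ℝ → ℝ} {Er : ℤ → ℝ → ℝ}

/-- The error weight of (6.45)–(6.48) at scale `-1`, `C₁(1+ε₀)^{-2-n₀/2}√Ẽ₋₁`, is at most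
`C₁(1+ε₀)^{-2-n₀/2}√E₁` when `Ẽ₋₁ ≤ E₁`. [cite: Tao2016AveragedNS, §6.4 (6.45)] -/
theorem RescaledHypotheses.err_neg_one_le
    (h : RescaledHypotheses γ ε₀ K ε C₁ C₂ C₃ n₀ N τ Xr Er) (hC₁ : 0 ≤ C₁) (hε₀ : -1 < ε₀)
    {t E₁ : ℝ} (hEm : Er (-1) t ≤ E₁) :
    C₁ * (1 + ε₀) ^ (-2 - (n₀ : ℝ) / 2) * Real.sqrt (Er (-1) t) ≤
      C₁ * (1 + ε₀) ^ (-2 - (n₀ : ℝ) / 2) * Real.sqrt E₁ := by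
  have _ := h.tau_zero
  exact mul_le_mul_of_nonneg_left (Real.sqrt_le_sqrt hEm)
    (mul_nonneg hC₁ (Real.rpow_nonneg (by linarith) _))

/-- **(6.134) with explicit error.** At a time `t ≥ τ_{n₀-N}` with `Ẽ₋₁(t) ≤ E₁`, `Ẽ₋₂(t) ≤ E₂`
(`ε, K, C₁ ≥ 0`): `|∂ₜa₋₁ + (1+ε₀)^{-5/2}ε⁻²c₋₁d₋₁| ≤
(1+ε₀)^{-5/2}(2εE₁ + 2ε²e^{-K^{10}}E₁ + 2KE₂) + C₁(1+ε₀)^{-2-n₀/2}√E₁`.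
[cite: Tao2016AveragedNS, §6.6 (6.134)] -/
theorem RescaledHypotheses.eq_a_neg_one
    (h : RescaledHypotheses γ ε₀ K ε C₁ C₂ C₃ n₀ N τ Xr Er) (hε : 0 ≤ ε) (hK : 0 ≤ K) (hC₁ : 0 ≤ C₁)
    (hε₀ : -1 < ε₀) {t E₁ E₂ : ℝ} (ht : τ (n₀ - N) ≤ t) (hEm : Er (-1) t ≤ E₁)
    (hEm2 : Er (-2) t ≤ E₂) :
    |derivWithin (Xr 0 (-1)) (Ici (τ (n₀ - N))) t +
        (1 + ε₀) ^ (-((5 : ℝ) / 2)) * (ε ^ 2)⁻¹ * Xr 2 (-1) t * Xr 3 (-1) t| ≤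
      (1 + ε₀) ^ (-((5 : ℝ) / 2)) * (2 * ε * E₁ + 2 * ε ^ 2 * Real.exp (-K ^ 10) * E₁ + 2 * K * E₂) +
        C₁ * (1 + ε₀) ^ (-2 - (n₀ : ℝ) / 2) * Real.sqrt E₁ := by
  have h1 := h.eq1 (-1) t ht
  simp only [Int.reduceNeg, Int.cast_neg, Int.cast_one, mul_neg, mul_one, neg_div,
    Int.reduceSub] at h1
  have hQ : 0 < (1 + ε₀) ^ (-((5 : ℝ) / 2)) := Real.rpow_pos_of_pos (by linarith) _
  set Q := (1 + ε₀) ^ (-((5 : ℝ) / 2)) with hQdef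
  have hab := h.abs_mul_le_two_mul_energy 0 1 (-1) ht
  have hac := h.abs_mul_le_two_mul_energy 0 2 (-1) ht
  have hdd := h.sq_le_two_mul_energy 3 (-2) ht
  have herr := h.err_neg_one_le hC₁ hε₀ hEm
  have hexp : (-2 : ℝ) - n₀ / 2 = -2 - (n₀ : ℝ) / 2 := rfl
  have key : derivWithin (Xr 0 (-1)) (Ici (τ (n₀ - N))) t + Q * (ε ^ 2)⁻¹ * Xr 2 (-1) t * Xr 3 (-1) t =
      (derivWithin (Xr 0 (-1)) (Ici (τ (n₀ - N))) t -
        Q * (-(ε ^ 2)⁻¹ * Xr 2 (-1) t * Xr 3 (-1) t - ε * Xr 0 (-1) t * Xr 1 (-1) t -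
          ε ^ 2 * Real.exp (-K ^ 10) * Xr 0 (-1) t * Xr 2 (-1) t + K * Xr 3 (-2) t ^ 2)) +
      Q * (-(ε * (Xr 0 (-1) t * Xr 1 (-1) t)) -
        ε ^ 2 * Real.exp (-K ^ 10) * (Xr 0 (-1) t * Xr 2 (-1) t) + K * Xr 3 (-2) t ^ 2) := by ring
  rw [key]
  refine (abs_add_le _ _).trans (add_le_add (h1.trans herr) ?_ |>.trans_eq (add_comm _ _))
  rw [abs_mul, abs_of_pos hQ]
  apply mul_le_mul_of_nonneg_left _ hQ.le
  have t1 : |-(ε * (Xr 0 (-1) t * Xr 1 (-1) t))| ≤ 2 * ε * E₁ := by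
    rw [abs_neg, abs_mul, abs_of_nonneg hε]; nlinarith
  have t2 : |ε ^ 2 * Real.exp (-K ^ 10) * (Xr 0 (-1) t * Xr 2 (-1) t)| ≤
      2 * ε ^ 2 * Real.exp (-K ^ 10) * E₁ := by
    have h0 : 0 ≤ ε ^ 2 * Real.exp (-K ^ 10) := by positivity
    rw [abs_mul, abs_of_nonneg h0]; nlinarith
  have t3 : |K * Xr 3 (-2) t ^ 2| ≤ 2 * K * E₂ := by
    rw [abs_mul, abs_of_nonneg hK, abs_of_nonneg (sq_nonneg _)]; nlinarith
  have hs1 := abs_add_le (-(ε * (Xr 0 (-1) t * Xr 1 (-1) t)) -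
    ε ^ 2 * Real.exp (-K ^ 10) * (Xr 0 (-1) t * Xr 2 (-1) t)) (K * Xr 3 (-2) t ^ 2)
  have hs2 := abs_sub (-(ε * (Xr 0 (-1) t * Xr 1 (-1) t)))
    (ε ^ 2 * Real.exp (-K ^ 10) * (Xr 0 (-1) t * Xr 2 (-1) t))
  linarith

/-- **(6.135) with explicit error**: `|∂ₜb₋₁ - (1+ε₀)^{-5/2}(εa₋₁² - ε⁻¹K^{10}c₋₁²)| ≤
C₁(1+ε₀)^{-2-n₀/2}√E₁` when `Ẽ₋₁(t) ≤ E₁`. [cite: Tao2016AveragedNS, §6.6 (6.135)] -/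
theorem RescaledHypotheses.eq_b_neg_one
    (h : RescaledHypotheses γ ε₀ K ε C₁ C₂ C₃ n₀ N τ Xr Er) (hC₁ : 0 ≤ C₁) (hε₀ : -1 < ε₀)
    {t E₁ : ℝ} (ht : τ (n₀ - N) ≤ t) (hEm : Er (-1) t ≤ E₁) :
    |derivWithin (Xr 1 (-1)) (Ici (τ (n₀ - N))) t -
        (1 + ε₀) ^ (-((5 : ℝ) / 2)) * (ε * Xr 0 (-1) t ^ 2 - ε⁻¹ * K ^ 10 * Xr 2 (-1) t ^ 2)| ≤
      C₁ * (1 + ε₀) ^ (-2 - (n₀ : ℝ) / 2) * Real.sqrt E₁ := by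
  have h2 := h.eq2 (-1) t ht
  simp only [Int.reduceNeg, Int.cast_neg, Int.cast_one, mul_neg, mul_one, neg_div] at h2
  exact h2.trans (h.err_neg_one_le hC₁ hε₀ hEm)

/-- **(6.136) with explicit error**: `|∂ₜc₋₁ - (1+ε₀)^{-5/2}(ε²e^{-K^{10}}a₋₁² + ε⁻¹K^{10}b₋₁c₋₁)| ≤
C₁(1+ε₀)^{-2-n₀/2}√E₁` when `Ẽ₋₁(t) ≤ E₁`. [cite: Tao2016AveragedNS, §6.6 (6.136)] -/
theorem RescaledHypotheses.eq_c_neg_one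
    (h : RescaledHypotheses γ ε₀ K ε C₁ C₂ C₃ n₀ N τ Xr Er) (hC₁ : 0 ≤ C₁) (hε₀ : -1 < ε₀)
    {t E₁ : ℝ} (ht : τ (n₀ - N) ≤ t) (hEm : Er (-1) t ≤ E₁) :
    |derivWithin (Xr 2 (-1)) (Ici (τ (n₀ - N))) t -
        (1 + ε₀) ^ (-((5 : ℝ) / 2)) *
          (ε ^ 2 * Real.exp (-K ^ 10) * Xr 0 (-1) t ^ 2 + ε⁻¹ * K ^ 10 * Xr 1 (-1) t * Xr 2 (-1) t)| ≤
      C₁ * (1 + ε₀) ^ (-2 - (n₀ : ℝ) / 2) * Real.sqrt E₁ := by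
  have h3 := h.eq3 (-1) t ht
  simp only [Int.reduceNeg, Int.cast_neg, Int.cast_one, mul_neg, mul_one, neg_div] at h3
  exact h3.trans (h.err_neg_one_le hC₁ hε₀ hEm)

/-- **(6.137) with explicit error**: `|∂ₜd₋₁ - ((1+ε₀)^{-5/2}ε⁻²c₋₁a₋₁ - Kd₋₁a₀)| ≤
C₁(1+ε₀)^{-2-n₀/2}√E₁` when `Ẽ₋₁(t) ≤ E₁` (the prefactors `(1+ε₀)^{∓5/2}` of the coupling to `a₀`
cancel). [cite: Tao2016AveragedNS, §6.6 (6.137)] -/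
theorem RescaledHypotheses.eq_d_neg_one
    (h : RescaledHypotheses γ ε₀ K ε C₁ C₂ C₃ n₀ N τ Xr Er) (hC₁ : 0 ≤ C₁) (hε₀ : -1 < ε₀)
    {t E₁ : ℝ} (ht : τ (n₀ - N) ≤ t) (hEm : Er (-1) t ≤ E₁) :
    |derivWithin (Xr 3 (-1)) (Ici (τ (n₀ - N))) t -
        ((1 + ε₀) ^ (-((5 : ℝ) / 2)) * (ε ^ 2)⁻¹ * Xr 2 (-1) t * Xr 0 (-1) t -
          K * Xr 3 (-1) t * Xr 0 0 t)| ≤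
      C₁ * (1 + ε₀) ^ (-2 - (n₀ : ℝ) / 2) * Real.sqrt E₁ := by
  have h4 := h.eq4 (-1) t ht
  simp only [Int.reduceNeg, Int.cast_neg, Int.cast_one, mul_neg, mul_one, neg_div,
    Int.reduceAdd] at h4
  have h0 : (0 : ℝ) < 1 + ε₀ := by linarith
  have hcancel : (1 + ε₀) ^ (-((5 : ℝ) / 2)) * (1 + ε₀) ^ ((5 : ℝ) / 2) = 1 := by
    rw [← Real.rpow_add h0]; norm_num
  have key : (1 + ε₀) ^ (-((5 : ℝ) / 2)) * (ε ^ 2)⁻¹ * Xr 2 (-1) t * Xr 0 (-1) t -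
        K * Xr 3 (-1) t * Xr 0 0 t =
      (1 + ε₀) ^ (-((5 : ℝ) / 2)) *
        ((ε ^ 2)⁻¹ * Xr 2 (-1) t * Xr 0 (-1) t -
          (1 + ε₀) ^ ((5 : ℝ) / 2) * K * Xr 3 (-1) t * Xr 0 0 t) := by
    have : K * Xr 3 (-1) t * Xr 0 0 t =
        ((1 + ε₀) ^ (-((5 : ℝ) / 2)) * (1 + ε₀) ^ ((5 : ℝ) / 2)) * K * Xr 3 (-1) t * Xr 0 0 t := by
      rw [hcancel, one_mul]
    rw [this]; ring
  rw [key]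
  exact h4.trans (h.err_neg_one_le hC₁ hε₀ hEm)

/-- **The energy inequality (6.49) at scale `-1` with the input term bounded** ((6.177):
"`∂ₜẼ₋₁ ≤ -Kd₋₁²a₀ + O(K^{-14})`"): when `Ẽ₋₁(t) ≤ E₁` and `Ẽ₋₂(t) ≤ E₂` (`K ≥ 0`),
`∂ₜẼ₋₁ ≤ -K d₋₁² a₀ + 2K(1+ε₀)^{-5/2} E₂ √(2E₁)`. [cite: Tao2016AveragedNS, §6.7 (6.177)] -/
theorem RescaledHypotheses.energy_neg_one_deriv_le
    (h : RescaledHypotheses γ ε₀ K ε C₁ C₂ C₃ n₀ N τ Xr Er) (hK : 0 ≤ K) (hε₀ : -1 < ε₀)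
    {t E₁ E₂ : ℝ} (ht : τ (n₀ - N) ≤ t) (hEm : Er (-1) t ≤ E₁) (hEm2 : Er (-2) t ≤ E₂) :
    derivWithin (Er (-1)) (Ici (τ (n₀ - N))) t ≤
      -(K * Xr 3 (-1) t ^ 2 * Xr 0 0 t) +
        2 * K * (1 + ε₀) ^ (-((5 : ℝ) / 2)) * E₂ * Real.sqrt (2 * E₁) := by
  have hen := h.energy (-1) t ht
  simp only [Int.reduceNeg, Int.cast_neg, Int.cast_one, mul_neg, mul_one, neg_div,
    Int.reduceSub, Int.reduceAdd] at hen
  have h0 : (0 : ℝ) < 1 + ε₀ := by linarith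
  have hQ : 0 < (1 + ε₀) ^ (-((5 : ℝ) / 2)) := Real.rpow_pos_of_pos h0 _
  have hcancel : (1 + ε₀) ^ (-((5 : ℝ) / 2)) * (1 + ε₀) ^ ((5 : ℝ) / 2) = 1 := by
    rw [← Real.rpow_add h0]; norm_num
  have hdd := h.sq_le_two_mul_energy 3 (-2) ht
  have ha : |Xr 0 (-1) t| ≤ Real.sqrt (2 * E₁) :=
    (h.abs_le_sqrt_energy 0 (-1) ht).trans (Real.sqrt_le_sqrt (by linarith))
  have hE2 : 0 ≤ E₂ := le_trans (by nlinarith [sq_nonneg (Xr 3 (-2) t)]) hEm2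
  have t1 : Xr 3 (-2) t ^ 2 * Xr 0 (-1) t ≤ 2 * E₂ * Real.sqrt (2 * E₁) := by
    calc Xr 3 (-2) t ^ 2 * Xr 0 (-1) t ≤ Xr 3 (-2) t ^ 2 * |Xr 0 (-1) t| :=
          mul_le_mul_of_nonneg_left (le_abs_self _) (sq_nonneg _)
      _ ≤ (2 * E₂) * Real.sqrt (2 * E₁) :=
          mul_le_mul (hdd.trans (by linarith)) ha (abs_nonneg _) (by positivity)
  calc derivWithin (Er (-1)) (Ici (τ (n₀ - N))) t
      ≤ K * (1 + ε₀) ^ (-((5 : ℝ) / 2)) *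
          (Xr 3 (-2) t ^ 2 * Xr 0 (-1) t - (1 + ε₀) ^ ((5 : ℝ) / 2) * Xr 3 (-1) t ^ 2 * Xr 0 0 t) := hen
    _ = K * (1 + ε₀) ^ (-((5 : ℝ) / 2)) * (Xr 3 (-2) t ^ 2 * Xr 0 (-1) t) -
          ((1 + ε₀) ^ (-((5 : ℝ) / 2)) * (1 + ε₀) ^ ((5 : ℝ) / 2)) * K *
            Xr 3 (-1) t ^ 2 * Xr 0 0 t := by ring
    _ = K * (1 + ε₀) ^ (-((5 : ℝ) / 2)) * (Xr 3 (-2) t ^ 2 * Xr 0 (-1) t) -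
          K * Xr 3 (-1) t ^ 2 * Xr 0 0 t := by rw [hcancel, one_mul]
    _ ≤ _ := by
        have := mul_le_mul_of_nonneg_left t1 (mul_nonneg hK hQ.le)
        linarith

end CoarseModes

end TaoCascade

end Literature.Analysis.FluidPDE
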